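import Literature.Probability.RandomPlanarGeometry.SAWQuantitativeHWProduct
import Literature.Probability.RandomPlanarGeometry.HammersleyWelshSharp
import Mathlib.Analysis.Real.Pi.Bounds
import HarnessLib

/-!
# Quantitative Hammersley–Welsh from a RATIONAL-window bridge height decay: `B(v) = π√(2v/3)` for every speed
# `v = p/q` (every `d`)

Topic `Literature/Probability/RandomPlanarGeometry`, continuing `SAWQuantitativeHW.lean` (Hutchcroft 2018: windowed
hypothesis `Zd.BridgeHeightDecayWindow d ℓ A c` with INTEGER aspect ratio `ℓ`, Lemma 2.4 `Zd.brGF_subcrit_le(_pow)`) and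
`SAWQuantitativeHWProduct.lean` (product-form Theorem 1.4: `Zd.count_le_of_window_prod`, `Zd.count_le_exp_sharp_of_window`,
exponent `π√(2/(3ℓ))`).

Source: T. Hutchcroft, Electron. Commun. Probab. 23 (2018), Lemma 2.4 with its REAL parameter `λ ≥ 1`:
"`ξ((1-ε)z_c) ≥ min{-λ log(1-ε), -log(1-ε) + Φ(λ^{-1})}` for every `ε > 0` and `λ ≥ 1`" (2.4), and Theorem 1.4;
N. Madras, G. Slade (1993), Theorem 3.1.1 (`π(2/3)^{1/2}`). The tree typed `λ` as an integer `ℓ`; this file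
types a RATIONAL `λ = q/p` through the window condition `p·m ≤ q·n` and proves Lemma 2.4 at spans `n = p n'`
(integer powers `((1-ε)^q)^{n'}`, `((1-ε)^p e^{-cp})^{n'}`), Fekete in `n'`, and one `p`-th root — so the
`√N`-constant under a window at speed `v = p/q` is `B(v) = π√(2v/3)` (lane pcv-sawmu item R7 "X19♯"; statements
typed by the planner a-idea-1, `Sketch_G4_WindowQ.lean`; the dictionary `v ↦ π√(2v/3)` as a theorem is this file's,
not in print).

## Contents (namespace `Literature.Probability.RandomPlanarGeometry.SAW.Zd`), all PROVED but the def
* `BridgeHeightDecayWindowQ d p q A c` (def), `windowQ_one_of_window`, `BridgeHeightDecayWindowQ.nonneg`;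
* `brGF_subcrit_le_Q`, `brGF_pow_subcrit_le_Q`, `brGF_subcrit_le_rpow_Q` — Lemma 2.4 / (2.4) at `λ = q/p`;
* `pow_mul_exp_neg_le_pow_of_regimeQ`, **`count_le_of_windowQ_prod`** — `c_N ≤ exp(pπ²/(6qε')) μ^{N+1}/(1-ε')^{N+1}`;
* `count_le_exp_sharp_of_realWindowBound` (real aspect ratio calculus), **`count_le_exp_sharp_of_windowQ`** —
  `c_N ≤ exp(π√(2pN/(3q)) + π²p/(3q) + 1) μ^{N+1}` for `2π²p ≤ 3qN`, `π²p((q-p)/(pc)+1)² ≤ 6qN`.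
-/

noncomputable section

open Finset Filter Topology Literature.Probability.RandomPlanarGeometry.SAW

namespace Literature.Probability.RandomPlanarGeometry.SAW.Zd


/-- **Rational-window bridge height decay** at aspect ratio `q/p` (speeds `≥ p/q`): for bridge length `m` and
height `n` with `1 ≤ n ≤ m` and `p m ≤ q n`, `#{ω ∈ bridges d m : ω_m(0) ≥ n} ≤ A · b_m · e^{-c n}` — Hutchcroft's
windowed hypothesis (1.1) (tree: `Zd.BridgeHeightDecayWindow d ℓ A c`, the case `p = 1`, `q = ℓ`) with a rational
aspect ratio, so that every certified speed `v = p/q > v₀` is usable (typed by the lane's planner a-idea-1).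
[cite: Hutchcroft2018HammersleyWelsh, eq. (1.1) and proof of Lemma 2.4 (windowed reading, real `λ = q/p`)] -/
def BridgeHeightDecayWindowQ (d : ℕ) [NeZero d] (p q : ℕ) (A c : ℝ) : Prop :=
  ∀ m n : ℕ, 1 ≤ n → n ≤ m → p * m ≤ q * n →
    ((((Zd.bridges d m).filter fun ω => (n : ℤ) ≤ ω m 0).card : ℝ)) ≤
      A * (Zd.bridgeCount d m : ℝ) * Real.exp (-(c * n))

variable {d : ℕ} [NeZero d]

/-- The integer window is the case `p = 1`. [cite: Hutchcroft2018HammersleyWelsh, eq. (1.1)] -/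
theorem windowQ_one_of_window {ℓ : ℕ} {A c : ℝ} (h : Zd.BridgeHeightDecayWindow d ℓ A c) :
    BridgeHeightDecayWindowQ d 1 ℓ A c := by
  intro m n hn hnm hpm
  exact h m n hn hnm (by simpa using hpm)

/-- The prefactor of a nonempty rational window (`p ≤ q`) is nonnegative (test at `m = n = 1`). [cite: Hutchcroft2018HammersleyWelsh, eq. (1.1)] -/
theorem BridgeHeightDecayWindowQ.nonneg {p q : ℕ} {A c : ℝ} (h : BridgeHeightDecayWindowQ d p q A c)
    (hpq : p ≤ q) : 0 ≤ A := by
  have h1 := h 1 1 le_rfl le_rfl (by simpa using hpq)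
  have hb : (0 : ℝ) < Zd.bridgeCount d 1 := by exact_mod_cast Zd.one_le_bridgeCount (d := d) 1
  have he : 0 < Real.exp (-(c * ((1 : ℕ) : ℝ))) := Real.exp_pos _
  have h0 : (0 : ℝ) ≤ (((Zd.bridges d 1).filter fun ω => ((1 : ℕ) : ℤ) ≤ ω 1 0).card : ℝ) := Nat.cast_nonneg _
  by_contra hA
  push Not at hA
  have : A * (Zd.bridgeCount d 1 : ℝ) * Real.exp (-(c * ((1 : ℕ) : ℝ))) < 0 :=
    mul_neg_of_neg_of_pos (mul_neg_of_neg_of_pos hA hb) he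
  linarith

/-- **Lemma 2.4, finite form, rational window, at spans `n = p n'`**: for `z = (1-ε) z_c`, `n' ≥ 1`, any `M`,
`V_M(z; p n') ≤ (1-ε)^{q n'} + (q n' + 1) · A · (1-ε)^{p n'} · e^{-c p n'}` (lengths `m > q n'`: Lemma 2.3
`Zd.brGF_critical_le_one`; lengths `p n' ≤ m ≤ q n'`: the window) — `Zd.brGF_subcrit_le` with `ℓ n ↦ q n'`.
[cite: Hutchcroft2018HammersleyWelsh, Lemma 2.4 (proof)] -/
theorem brGF_subcrit_le_Q {p q : ℕ} {A c : ℝ} (h : BridgeHeightDecayWindowQ d p q A c) (hp : 1 ≤ p)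
    (hpq : p ≤ q) {ε : ℝ} (hε0 : 0 < ε) (hε1 : ε < 1) {n' : ℕ} (hn : 1 ≤ n') (M : ℕ) :
    Zd.brGF d M ((1 - ε) * (Zd.connectiveConstant d)⁻¹) ((p * n' : ℕ) : ℤ) ≤
      (1 - ε) ^ (q * n') +
        ((q * n' + 1 : ℕ) : ℝ) * A * (1 - ε) ^ (p * n') * Real.exp (-(c * ((p * n' : ℕ) : ℝ))) := by
  classical
  have hμ := Zd.connectiveConstant_pos d
  set zc : ℝ := (Zd.connectiveConstant d)⁻¹ with hzc
  have hzc0 : 0 < zc := inv_pos.2 hμ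
  have hA := h.nonneg hpq
  have h1ε : 0 ≤ 1 - ε := by linarith
  have h1ε1 : 1 - ε ≤ 1 := by linarith
  set n : ℕ := p * n' with hndef
  have hn1 : 1 ≤ n := Nat.mul_le_mul hp hn
  have hnq : n ≤ q * n' := Nat.mul_le_mul_right _ hpq
  set g : ℝ := A * (1 - ε) ^ n * Real.exp (-(c * n)) with hg
  have hg0 : 0 ≤ g := by positivity
  set f : ℕ → ℝ := fun m => ((Zd.brSpan d m (n : ℤ)).card : ℝ) * ((1 - ε) * zc) ^ m with hf
  have hf0 : ∀ m, 0 ≤ f m := fun m => by positivity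
  have hsplit : Zd.brGF d M ((1 - ε) * zc) n =
      ∑ m ∈ (Finset.range (M + 1)).filter (fun m => m ≤ q * n'), f m +
        ∑ m ∈ (Finset.range (M + 1)).filter (fun m => ¬ m ≤ q * n'), f m := by
    rw [Zd.brGF, Finset.sum_filter_add_sum_filter_not]
  -- TAIL: lengths `m > q n'`
  have htail : ∑ m ∈ (Finset.range (M + 1)).filter (fun m => ¬ m ≤ q * n'), f m ≤ (1 - ε) ^ (q * n') := by
    calc ∑ m ∈ (Finset.range (M + 1)).filter (fun m => ¬ m ≤ q * n'), f m
        ≤ ∑ m ∈ (Finset.range (M + 1)).filter (fun m => ¬ m ≤ q * n'),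
            (1 - ε) ^ (q * n') * (((Zd.brSpan d m (n : ℤ)).card : ℝ) * zc ^ m) := by
          refine Finset.sum_le_sum fun m hm => ?_
          rw [Finset.mem_filter] at hm
          have hle : (1 - ε) ^ m ≤ (1 - ε) ^ (q * n') := pow_le_pow_of_le_one h1ε h1ε1 (by omega)
          rw [hf]
          dsimp only
          rw [mul_pow]
          calc ((Zd.brSpan d m (n : ℤ)).card : ℝ) * ((1 - ε) ^ m * zc ^ m)
              = (1 - ε) ^ m * (((Zd.brSpan d m (n : ℤ)).card : ℝ) * zc ^ m) := by ring
            _ ≤ (1 - ε) ^ (q * n') * (((Zd.brSpan d m (n : ℤ)).card : ℝ) * zc ^ m) :=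
                mul_le_mul_of_nonneg_right hle (by positivity)
      _ = (1 - ε) ^ (q * n') * ∑ m ∈ (Finset.range (M + 1)).filter (fun m => ¬ m ≤ q * n'),
            ((Zd.brSpan d m (n : ℤ)).card : ℝ) * zc ^ m := by rw [Finset.mul_sum]
      _ ≤ (1 - ε) ^ (q * n') * Zd.brGF d M zc n := by
          refine mul_le_mul_of_nonneg_left ?_ (pow_nonneg h1ε _)
          rw [Zd.brGF]
          exact Finset.sum_le_sum_of_subset_of_nonneg (Finset.filter_subset _ _)
            fun m _ _ => by positivity
      _ ≤ (1 - ε) ^ (q * n') * 1 :=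
          mul_le_mul_of_nonneg_left (Zd.brGF_critical_le_one M (n : ℤ)) (pow_nonneg h1ε _)
      _ = (1 - ε) ^ (q * n') := mul_one _
  -- HEAD: lengths `m ≤ q n'`; each term is `≤ g`
  have hterm : ∀ m, m ≤ q * n' → f m ≤ g := by
    intro m hmq
    rcases lt_or_ge m n with hmn | hmn
    · have : (Zd.brSpan d m (n : ℤ)).card = 0 := by
        rw [Finset.card_eq_zero, Finset.eq_empty_iff_forall_notMem]
        intro ω hω
        obtain ⟨hωb, hωn⟩ := Zd.mem_brSpan.1 hω
        obtain ⟨h00, -, hadj, -⟩ := Zd.mem_saws.1 (Zd.mem_bridges.1 hωb).1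
        have hb := Zd.abs_apply_le_of_adj h00 hadj m le_rfl 0
        rw [hωn] at hb
        have : (n : ℤ) ≤ m := (le_abs_self _).trans hb
        omega
      rw [hf]; dsimp only; rw [this, Nat.cast_zero, zero_mul]; exact hg0
    · have hwin : p * m ≤ q * n := by
        calc p * m ≤ p * (q * n') := Nat.mul_le_mul_left _ hmq
          _ = q * (p * n') := by ring
          _ = q * n := by rw [hndef]
      have hcard : ((Zd.brSpan d m (n : ℤ)).card : ℝ) ≤
          A * (Zd.bridgeCount d m : ℝ) * Real.exp (-(c * n)) := by
        refine le_trans ?_ (h m n hn1 hmn hwin)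
        exact_mod_cast Finset.card_le_card (fun ω hω => by
          rw [Finset.mem_filter]
          obtain ⟨hωb, hωn⟩ := Zd.mem_brSpan.1 hω
          exact ⟨hωb, hωn.ge⟩)
      have hbz : (Zd.bridgeCount d m : ℝ) * zc ^ m ≤ 1 := by
        calc (Zd.bridgeCount d m : ℝ) * zc ^ m ≤ Zd.connectiveConstant d ^ m * zc ^ m :=
              mul_le_mul_of_nonneg_right (Zd.bridgeCount_le_pow m) (pow_nonneg hzc0.le m)
          _ = 1 := by rw [← mul_pow, hzc, mul_inv_cancel₀ hμ.ne', one_pow]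
      have hpow : (1 - ε) ^ m ≤ (1 - ε) ^ n := pow_le_pow_of_le_one h1ε h1ε1 hmn
      rw [hf]; dsimp only
      rw [mul_pow]
      calc ((Zd.brSpan d m (n : ℤ)).card : ℝ) * ((1 - ε) ^ m * zc ^ m)
          ≤ (A * (Zd.bridgeCount d m : ℝ) * Real.exp (-(c * n))) * ((1 - ε) ^ m * zc ^ m) :=
            mul_le_mul_of_nonneg_right hcard (by positivity)
        _ = A * ((Zd.bridgeCount d m : ℝ) * zc ^ m) * (1 - ε) ^ m * Real.exp (-(c * n)) := by ring
        _ ≤ A * 1 * (1 - ε) ^ n * Real.exp (-(c * n)) := by gcongr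
        _ = g := by rw [hg, mul_one]
  have hhead : ∑ m ∈ (Finset.range (M + 1)).filter (fun m => m ≤ q * n'), f m ≤
      ((q * n' + 1 : ℕ) : ℝ) * g := by
    calc ∑ m ∈ (Finset.range (M + 1)).filter (fun m => m ≤ q * n'), f m
        ≤ ∑ m ∈ Finset.range (q * n' + 1), f m := by
          refine Finset.sum_le_sum_of_subset_of_nonneg ?_ fun m _ _ => hf0 m
          intro m hm
          rw [Finset.mem_filter] at hm
          rw [Finset.mem_range]; omega
      _ ≤ ∑ _m ∈ Finset.range (q * n' + 1), g :=
          Finset.sum_le_sum fun m hm => hterm m (Nat.le_of_lt_succ (Finset.mem_range.1 hm))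
      _ = ((q * n' + 1 : ℕ) : ℝ) * g := by
          rw [Finset.sum_const, Finset.card_range, nsmul_eq_mul]
  rw [hsplit, hg] at *
  calc _ ≤ ((q * n' + 1 : ℕ) : ℝ) * (A * (1 - ε) ^ n * Real.exp (-(c * n))) + (1 - ε) ^ (q * n') :=
        add_le_add hhead htail
    _ = _ := by rw [hndef]; ring

/-- Fekete-type extraction of a rate (copy of the private `le_of_pow_le` of `SAWQuantitativeHW.lean`): if
`x^k ≤ C · k · r^k` for all `k ≥ 1` (`r > 0`), then `x ≤ r`. [folklore] -/
private theorem le_of_pow_le' {x r C : ℝ} (hr : 0 < r)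
    (h : ∀ k : ℕ, 1 ≤ k → x ^ k ≤ C * k * r ^ k) : x ≤ r := by
  by_contra hxr
  push Not at hxr
  have hx : 0 < x := hr.trans hxr
  set t : ℝ := r / x with ht
  have ht0 : 0 < t := div_pos hr hx
  have ht1 : t < 1 := (div_lt_one hx).2 hxr
  have hrt : r = t * x := by rw [ht, div_mul_cancel₀ _ hx.ne']
  have hT : Tendsto (fun n : ℕ => C * (((n : ℝ)) ^ 1 * t ^ n)) atTop (𝓝 (C * 0)) :=
    (tendsto_pow_const_mul_const_pow_of_abs_lt_one 1
      (by rw [abs_of_pos ht0]; exact ht1)).const_mul C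
  rw [mul_zero] at hT
  obtain ⟨n, hn⟩ := (hT.eventually (eventually_lt_nhds zero_lt_one)).exists_forall_of_atTop
  set k : ℕ := max n 1 with hk
  have key := h k (le_max_right _ _)
  have hlt := hn k (le_max_left _ _)
  have hxk : 0 < x ^ k := pow_pos hx _
  rw [hrt, mul_pow] at key
  have h1 : C * (k : ℝ) * (t ^ k * x ^ k) = (C * (((k : ℝ)) ^ 1 * t ^ k)) * x ^ k := by ring
  rw [h1] at key
  have h2 : (C * (((k : ℝ)) ^ 1 * t ^ k)) * x ^ k < 1 * x ^ k := mul_lt_mul_of_pos_right hlt hxk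
  linarith

/-- **Span rate under the rational window** (Lemma 2.4 + Fekete in `n'`; the prefactor `A` drops out): for every
span `a ≥ 1` and every truncation `M`, `V_M((1-ε)z_c; a)^p ≤ ρ_*^a` with `ρ_* = max((1-ε)^q, (1-ε)^p e^{-cp})` — from
`V_M(a)^{pk} ≤ V_{pkM}(pka)` (`Zd.brGF_pow_le`) and `brGF_subcrit_le_Q` at `n' = ka`.
[cite: Hutchcroft2018HammersleyWelsh, Lemma 2.4, eq. (2.4) and eq. (2.2)] -/
theorem brGF_pow_subcrit_le_Q {p q : ℕ} {A c : ℝ} (h : BridgeHeightDecayWindowQ d p q A c) (hp : 1 ≤ p)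
    (hpq : p ≤ q) {ε : ℝ} (hε0 : 0 < ε) (hε1 : ε < 1) (M : ℕ) {a : ℕ} (ha : 1 ≤ a) :
    Zd.brGF d M ((1 - ε) * (Zd.connectiveConstant d)⁻¹) a ^ p ≤
      (max ((1 - ε) ^ q) ((1 - ε) ^ p * Real.exp (-(c * p)))) ^ a := by
  set ρ : ℝ := max ((1 - ε) ^ q) ((1 - ε) ^ p * Real.exp (-(c * p))) with hρ
  set z : ℝ := (1 - ε) * (Zd.connectiveConstant d)⁻¹ with hz
  have hA := h.nonneg hpq
  have h1ε : 0 < 1 - ε := by linarith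
  have hz0 : 0 ≤ z := by
    have := Zd.connectiveConstant_pos d
    positivity
  have hρ0 : 0 < ρ := lt_max_of_lt_left (pow_pos h1ε q)
  have hρ1 : (1 - ε) ^ q ≤ ρ := le_max_left _ _
  have hρ2 : (1 - ε) ^ p * Real.exp (-(c * p)) ≤ ρ := le_max_right _ _
  have hV0 : 0 ≤ Zd.brGF d M z a := Finset.sum_nonneg fun n _ => by positivity
  refine le_of_pow_le' (C := 1 + ((q * a + 1 : ℕ) : ℝ) * A) (pow_pos hρ0 a) fun k hk => ?_
  have hka : 1 ≤ k * a := Nat.mul_le_mul hk ha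
  have hcast : ((p * k : ℕ) : ℤ) * (a : ℤ) = ((p * (k * a) : ℕ) : ℤ) := by push_cast; ring
  calc (Zd.brGF d M z a ^ p) ^ k = Zd.brGF d M z a ^ (p * k) := by rw [← pow_mul]
    _ ≤ Zd.brGF d ((p * k) * M) z ((p * k : ℕ) * (a : ℤ)) := Zd.brGF_pow_le M hz0 a (p * k)
    _ = Zd.brGF d ((p * k) * M) z ((p * (k * a) : ℕ) : ℤ) := by rw [hcast]
    _ ≤ (1 - ε) ^ (q * (k * a)) + ((q * (k * a) + 1 : ℕ) : ℝ) * A * (1 - ε) ^ (p * (k * a)) *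
          Real.exp (-(c * ((p * (k * a) : ℕ) : ℝ))) :=
        brGF_subcrit_le_Q h hp hpq hε0 hε1 hka ((p * k) * M)
    _ ≤ ρ ^ (k * a) + ((q * (k * a) + 1 : ℕ) : ℝ) * A * ρ ^ (k * a) := by
        have e1 : (1 - ε) ^ (q * (k * a)) ≤ ρ ^ (k * a) := by
          rw [pow_mul]
          exact pow_le_pow_left₀ (pow_nonneg h1ε.le q) hρ1 _
        have e2 : (1 - ε) ^ (p * (k * a)) * Real.exp (-(c * ((p * (k * a) : ℕ) : ℝ))) ≤ ρ ^ (k * a) := by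
          rw [show -(c * ((p * (k * a) : ℕ) : ℝ)) = ((k * a : ℕ) : ℝ) * (-(c * p)) by push_cast; ring,
            Real.exp_nat_mul, pow_mul, ← mul_pow]
          exact pow_le_pow_left₀ (by positivity) hρ2 _
        calc (1 - ε) ^ (q * (k * a)) + ((q * (k * a) + 1 : ℕ) : ℝ) * A * (1 - ε) ^ (p * (k * a)) *
              Real.exp (-(c * ((p * (k * a) : ℕ) : ℝ)))
            = (1 - ε) ^ (q * (k * a)) + ((q * (k * a) + 1 : ℕ) : ℝ) * A * ((1 - ε) ^ (p * (k * a)) *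
              Real.exp (-(c * ((p * (k * a) : ℕ) : ℝ)))) := by ring
          _ ≤ ρ ^ (k * a) + ((q * (k * a) + 1 : ℕ) : ℝ) * A * ρ ^ (k * a) := by gcongr
    _ = (1 + ((q * (k * a) + 1 : ℕ) : ℝ) * A) * ρ ^ (k * a) := by ring
    _ ≤ ((1 + ((q * a + 1 : ℕ) : ℝ) * A) * k) * ρ ^ (k * a) := by
        refine mul_le_mul_of_nonneg_right ?_ (pow_nonneg hρ0.le _)
        have hk1 : (1 : ℝ) ≤ k := by exact_mod_cast hk
        have hcmp : ((q * (k * a) + 1 : ℕ) : ℝ) ≤ ((q * a + 1 : ℕ) : ℝ) * k := by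
          have : q * (k * a) + 1 ≤ (q * a + 1) * k := by nlinarith
          exact_mod_cast this
        nlinarith [mul_nonneg (Nat.cast_nonneg (q * a + 1)) hA]
    _ = (1 + ((q * a + 1 : ℕ) : ℝ) * A) * k * (ρ ^ a) ^ k := by
        rw [← pow_mul, mul_comm a k]

/-- **Real-exponent span rate**: `V_M((1-ε)z_c; a) ≤ (ρ_*^{1/p})^a` (one `p`-th root of `brGF_pow_subcrit_le_Q`);
`ρ_*^{1/p} = max((1-ε)^{q/p}, (1-ε)e^{-c})` is Hutchcroft's rate (2.4) at `λ = q/p`. [cite: Hutchcroft2018HammersleyWelsh, Lemma 2.4, eq. (2.4)] -/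
theorem brGF_subcrit_le_rpow_Q {p q : ℕ} {A c : ℝ} (h : BridgeHeightDecayWindowQ d p q A c) (hp : 1 ≤ p)
    (hpq : p ≤ q) {ε : ℝ} (hε0 : 0 < ε) (hε1 : ε < 1) (M : ℕ) {a : ℕ} (ha : 1 ≤ a) :
    Zd.brGF d M ((1 - ε) * (Zd.connectiveConstant d)⁻¹) a ≤
      ((max ((1 - ε) ^ q) ((1 - ε) ^ p * Real.exp (-(c * p)))) ^ ((1 : ℝ) / p)) ^ a := by
  set ρ : ℝ := max ((1 - ε) ^ q) ((1 - ε) ^ p * Real.exp (-(c * p))) with hρ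
  have h1ε : 0 < 1 - ε := by linarith
  have hρ0 : 0 < ρ := lt_max_of_lt_left (pow_pos h1ε q)
  have hV0 : 0 ≤ Zd.brGF d M ((1 - ε) * (Zd.connectiveConstant d)⁻¹) a :=
    Finset.sum_nonneg fun n _ => by
      have := Zd.connectiveConstant_pos d
      positivity
  have key := brGF_pow_subcrit_le_Q h hp hpq hε0 hε1 M ha
  have hp0 : (0 : ℝ) < p := by exact_mod_cast hp
  -- take `p`-th roots: `V = (V^p)^{1/p} ≤ (ρ^a)^{1/p} = (ρ^{1/p})^a`
  have e1 : Zd.brGF d M ((1 - ε) * (Zd.connectiveConstant d)⁻¹) a =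
      (Zd.brGF d M ((1 - ε) * (Zd.connectiveConstant d)⁻¹) a ^ p) ^ ((1 : ℝ) / p) := by
    rw [← Real.rpow_natCast, ← Real.rpow_mul hV0, mul_one_div_cancel hp0.ne', Real.rpow_one]
  have e2 : (ρ ^ a) ^ ((1 : ℝ) / p) = (ρ ^ ((1 : ℝ) / p)) ^ a := by
    rw [← Real.rpow_natCast, ← Real.rpow_mul hρ0.le, mul_comm, Real.rpow_mul hρ0.le, Real.rpow_natCast]
  rw [e1, ← e2]
  exact Real.rpow_le_rpow (pow_nonneg hV0 p) key (by positivity)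


/-! ## R7.2 — `count_le_of_windowQ_prod` (every `d`): the rational-window product bound -/


/-- The regime in `p`-th powers: `(q/p - 1)ε' ≤ c(1-ε')` (`1 ≤ p ≤ q`, `0 < ε' < 1`) ⇒
`(1-ε')^p e^{-cp} ≤ (1-ε')^q` (`Zd.mul_exp_neg_le_pow_of_regime` with `ℓ = q-p+1`, rate `cp`, times `(1-ε')^{p-1}`), so that the
rational-window rate `max((1-ε')^q, (1-ε')^p e^{-cp})` is `(1-ε')^q`. [cite: Hutchcroft2018HammersleyWelsh, Lemma 2.4, eq. (2.4)] -/
theorem pow_mul_exp_neg_le_pow_of_regimeQ {p q : ℕ} (hp : 1 ≤ p) (hpq : p ≤ q) {c ε' : ℝ}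
    (hε0 : 0 < ε') (hε1 : ε' < 1) (hreg : (((q : ℝ) / p) - 1) * ε' ≤ c * (1 - ε')) :
    (1 - ε') ^ p * Real.exp (-(c * p)) ≤ (1 - ε') ^ q := by
  have h1ε : 0 < 1 - ε' := by linarith
  have hp0 : (0 : ℝ) < p := by exact_mod_cast hp
  -- `(q - p) ε' ≤ (c p)(1 - ε')`
  have hreg' : ((((q - p + 1 : ℕ) : ℝ)) - 1) * ε' ≤ (c * p) * (1 - ε') := by
    have hcast : (((q - p + 1 : ℕ) : ℝ)) - 1 = (q : ℝ) - p := by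
      rw [Nat.cast_add, Nat.cast_sub hpq]; push_cast; ring
    rw [hcast]
    have := mul_le_mul_of_nonneg_left hreg hp0.le
    have e1 : (p : ℝ) * ((((q : ℝ) / p) - 1) * ε') = ((q : ℝ) - p) * ε' := by
      field_simp
    have e2 : (p : ℝ) * (c * (1 - ε')) = (c * p) * (1 - ε') := by ring
    linarith [e1, e2]
  have h4 := mul_exp_neg_le_pow_of_regime (ℓ := q - p + 1) (by omega) hε1 hreg'
  -- multiply by `(1-ε')^{p-1}`
  obtain ⟨p', rfl⟩ : ∃ p', p = p' + 1 := ⟨p - 1, by omega⟩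
  have hq : q = (q - (p' + 1) + 1) + p' := by omega
  calc (1 - ε') ^ (p' + 1) * Real.exp (-(c * ((p' + 1 : ℕ) : ℝ)))
      = (1 - ε') ^ p' * ((1 - ε') * Real.exp (-(c * ((p' + 1 : ℕ) : ℝ)))) := by ring
    _ ≤ (1 - ε') ^ p' * (1 - ε') ^ (q - (p' + 1) + 1) :=
        mul_le_mul_of_nonneg_left h4 (pow_nonneg h1ε.le _)
    _ = (1 - ε') ^ q := by rw [← pow_add]; congr 1; omega

/-- **Product-form Theorem 1.4 under a RATIONAL window** (aspect ratio `q/p`, speeds `≥ p/q`): in the regime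
`(q/p - 1) ε' ≤ c (1 - ε')`, for every `N`, `c_N ≤ exp(p π²/(6 q ε')) · μ^{N+1}/(1-ε')^{N+1}` — the integer-window
`Zd.count_le_of_window_prod` with `ℓ ↦ q/p` (span rate `σ = ((1-ε')^q)^{1/p}`, `-log σ ≥ qε'/p`). This file's constant.
[cite: Hutchcroft2018HammersleyWelsh, Theorem 1.4 and Lemma 2.4 (windowed hypothesis, product form)] -/
theorem count_le_of_windowQ_prod {p q : ℕ} {A c : ℝ} (h : BridgeHeightDecayWindowQ d p q A c)
    (hp : 1 ≤ p) (hpq : p ≤ q) {ε' : ℝ} (hε0 : 0 < ε') (hε1 : ε' < 1)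
    (hreg : (((q : ℝ) / p) - 1) * ε' ≤ c * (1 - ε')) (N : ℕ) :
    (Zd.count d N : ℝ) ≤
      Real.exp ((p : ℝ) * Real.pi ^ 2 / (6 * (q : ℝ) * ε')) *
        Zd.connectiveConstant d ^ (N + 1) / (1 - ε') ^ (N + 1) := by
  have hμ : 0 < Zd.connectiveConstant d := Zd.connectiveConstant_pos d
  have h1ε : 0 < 1 - ε' := by linarith
  have hp0 : (0 : ℝ) < p := by exact_mod_cast hp
  have hq0 : (0 : ℝ) < q := by exact_mod_cast (lt_of_lt_of_le hp hpq)
  set z : ℝ := (1 - ε') * (Zd.connectiveConstant d)⁻¹ with hz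
  have hz0 : 0 < z := by positivity
  -- the regime: `ρ_* = (1-ε')^q`
  have hmax : max ((1 - ε') ^ q) ((1 - ε') ^ p * Real.exp (-(c * p))) = (1 - ε') ^ q :=
    max_eq_left (pow_mul_exp_neg_le_pow_of_regimeQ hp hpq hε0 hε1 hreg)
  set σ : ℝ := ((1 - ε') ^ q) ^ ((1 : ℝ) / p) with hσ
  have hb0 : 0 < (1 - ε') ^ q := pow_pos h1ε q
  have hb1 : (1 - ε') ^ q < 1 := pow_lt_one₀ h1ε.le (by linarith) (by omega)
  have hσ0 : 0 < σ := Real.rpow_pos_of_pos hb0 _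
  have hσ1 : σ < 1 := Real.rpow_lt_one hb0.le hb1 (by positivity)
  -- Step A: span rate `V_M(z;a) ≤ σ^a`
  have hV : ∀ M a : ℕ, 1 ≤ a → Zd.brGF d M z a ≤ σ ^ a := by
    intro M a ha
    have key := brGF_subcrit_le_rpow_Q h hp hpq hε0 hε1 M ha
    rw [hmax] at key
    exact key
  -- Step B: `t = -log σ ≥ q ε'/p`
  have hlσ : Real.log σ = ((1 : ℝ) / p) * ((q : ℝ) * Real.log (1 - ε')) := by
    rw [hσ, Real.log_rpow hb0, Real.log_pow]
  have hlog1 : Real.log (1 - ε') ≤ -ε' := by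
    have := Real.log_le_sub_one_of_pos h1ε
    linarith
  have ht : (q : ℝ) * ε' / p ≤ -Real.log σ := by
    rw [hlσ]
    have e : -(1 / (p : ℝ) * ((q : ℝ) * Real.log (1 - ε'))) = (q : ℝ) * (-Real.log (1 - ε')) / p := by
      field_simp
    rw [e, div_le_div_iff_of_pos_right hp0]
    exact mul_le_mul_of_nonneg_left (by linarith) hq0.le
  have hqε : 0 < (q : ℝ) * ε' / p := by positivity
  have ht0 : 0 < -Real.log σ := lt_of_lt_of_le hqε ht
  -- Step C: the half-space sum at `M = N+1`
  have hS : ∑ n ∈ Finset.range (N + 2), (Zd.halfSpaceCount d n : ℝ) * z ^ n ≤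
      Real.exp (Real.pi ^ 2 / (12 * (-Real.log σ))) :=
    (sum_halfSpaceCount_le_prod (N + 1) hz0.le hσ0.le (hV (N + 1))).trans
      (prod_one_add_pow_le_exp hσ0 hσ1 (N + 1))
  have hS0 : 0 ≤ ∑ n ∈ Finset.range (N + 2), (Zd.halfSpaceCount d n : ℝ) * z ^ n :=
    Finset.sum_nonneg fun n _ => by positivity
  -- Step D: square and compare exponents
  have hexp : Real.pi ^ 2 / (12 * (-Real.log σ)) * 2 ≤ (p : ℝ) * Real.pi ^ 2 / (6 * (q : ℝ) * ε') := by
    rw [div_mul_eq_mul_div, div_le_div_iff₀ (by positivity) (by positivity)]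
    have hπ : 0 ≤ Real.pi ^ 2 := sq_nonneg _
    -- `π²·2·(6qε') ≤ pπ²·12·t` ⇐ `qε' ≤ p t`
    have ht' : (q : ℝ) * ε' ≤ (p : ℝ) * (-Real.log σ) := by
      have := mul_le_mul_of_nonneg_left ht hp0.le
      rwa [mul_div_cancel₀ _ hp0.ne'] at this
    nlinarith [mul_le_mul_of_nonneg_left ht' hπ]
  have hC : (Zd.count d N : ℝ) * z ^ (N + 1) ≤ Real.exp ((p : ℝ) * Real.pi ^ 2 / (6 * (q : ℝ) * ε')) :=
    calc (Zd.count d N : ℝ) * z ^ (N + 1)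
        ≤ (∑ n ∈ Finset.range (N + 2), (Zd.halfSpaceCount d n : ℝ) * z ^ n) ^ 2 :=
          count_mul_pow_le_sq N hz0.le
      _ ≤ (Real.exp (Real.pi ^ 2 / (12 * (-Real.log σ)))) ^ 2 := pow_le_pow_left₀ hS0 hS 2
      _ = Real.exp (Real.pi ^ 2 / (12 * (-Real.log σ)) * 2) := by
          rw [← Real.exp_nat_mul]; ring_nf
      _ ≤ Real.exp ((p : ℝ) * Real.pi ^ 2 / (6 * (q : ℝ) * ε')) := Real.exp_le_exp.2 hexp
  -- Step E: divide by `z^{N+1}`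
  have hzpow : z ^ (N + 1) = (1 - ε') ^ (N + 1) / Zd.connectiveConstant d ^ (N + 1) := by
    rw [hz, mul_pow, inv_pow, div_eq_mul_inv]
  rw [hzpow] at hC
  rw [le_div_iff₀ (pow_pos h1ε _)]
  have hμp : 0 < Zd.connectiveConstant d ^ (N + 1) := pow_pos hμ _
  have := mul_le_mul_of_nonneg_right hC hμp.le
  rw [mul_assoc, div_mul_cancel₀ _ hμp.ne'] at this
  linarith [this]

/-! ## R7.3 — the calculus (a-idea-1's R6.3b proof with a REAL aspect ratio `L ≥ 1`) and the headline -/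

/-- The `ε' := π/√(6LN)` optimisation for a REAL aspect ratio `L ≥ 1`: if
`c_N ≤ exp(π²/(6Lε')) μ^{N+1}/(1-ε')^{N+1}` for every admissible `ε'` in the regime `(L-1)ε' ≤ c(1-ε')`, then
`c_N ≤ exp(π√(2N/(3L)) + π²/(3L) + 1) μ^{N+1}` whenever `2π² ≤ 3LN` and `π²((L-1)/c + 1)² ≤ 6LN` (the calculus of
`Zd.count_le_exp_sharp_of_window`, typed by the lane's planner for integer `ℓ`, verbatim with `ℓ ↦ L`).
[cite: Hutchcroft2018HammersleyWelsh, Theorem 1.4; MadrasSlade1993, Theorem 3.1.1] -/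
theorem count_le_exp_sharp_of_realWindowBound {L c : ℝ} (hL : 1 ≤ L) (hc : 0 < c)
    (hA : ∀ ε' : ℝ, 0 < ε' → ε' < 1 → (L - 1) * ε' ≤ c * (1 - ε') → ∀ N : ℕ,
      (Zd.count d N : ℝ) ≤ Real.exp (Real.pi ^ 2 / (6 * L * ε')) *
        Zd.connectiveConstant d ^ (N + 1) / (1 - ε') ^ (N + 1))
    (N : ℕ) (hN1 : 2 * Real.pi ^ 2 ≤ 3 * L * N)
    (hN2 : Real.pi ^ 2 * ((L - 1) / c + 1) ^ 2 ≤ 6 * L * N) :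
    (Zd.count d N : ℝ) ≤
      Real.exp (Real.pi * Real.sqrt (2 * N / (3 * L)) + Real.pi ^ 2 / (3 * L) + 1) *
        Zd.connectiveConstant d ^ (N + 1) := by
  -- abbreviations
  have hπ : 0 < Real.pi := Real.pi_pos
  have hL0 : (0 : ℝ) < L := by linarith
  have hn0 : (0 : ℝ) ≤ (N : ℝ) := Nat.cast_nonneg N
  have h6Ln : (0 : ℝ) ≤ 6 * L * N := by positivity
  set s : ℝ := Real.sqrt (6 * L * N) with hs
  have hs2 : s ^ 2 = 6 * L * N := Real.sq_sqrt h6Ln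
  have hs0 : 0 ≤ s := Real.sqrt_nonneg _
  -- `2π ≤ s` from `hN1`, hence `s > π > 0`
  have h2πs : 2 * Real.pi ≤ s := by
    rw [hs, Real.le_sqrt (by positivity) h6Ln]
    nlinarith
  have hsπ : 0 < s - Real.pi := by linarith
  have hspos : 0 < s := by linarith
  -- the choice `ε' = π/s`
  set ε' : ℝ := Real.pi / s with hε'
  have hε0 : 0 < ε' := div_pos hπ hspos
  have hεhalf : ε' ≤ 1 / 2 := by
    rw [hε', div_le_iff₀ hspos]
    linarith
  have hε1 : ε' < 1 := by linarith
  -- the regime `(ℓ-1)ε' ≤ c(1-ε')` from `hN2`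
  have hπs : Real.pi * ((L - 1) / c + 1) ≤ s := by
    have h0 : 0 ≤ Real.pi * ((L - 1) / c + 1) := by
      have : 0 ≤ (L - 1) / c := div_nonneg (by linarith) hc.le
      positivity
    rw [hs, Real.le_sqrt h0 h6Ln, mul_pow]
    linarith [hN2]
  have hreg' : (L - 1) * Real.pi ≤ c * (s - Real.pi) := by
    have e : c * (Real.pi * ((L - 1) / c + 1)) = (L - 1) * Real.pi + c * Real.pi := by
      field_simp
    linarith [mul_le_mul_of_nonneg_left hπs hc.le, e]
  have hreg : (L - 1) * ε' ≤ c * (1 - ε') := by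
    have e1 : (L - 1) * ε' = ((L - 1) * Real.pi) / s := by
      rw [hε']; ring
    have e2 : c * (1 - ε') = (c * (s - Real.pi)) / s := by
      rw [hε']; field_simp
    rw [e1, e2]
    exact div_le_div_of_nonneg_right hreg' hs0
  -- R6.3a at this `ε'`
  have hA := hA ε' hε0 hε1 hreg N
  -- exponent bookkeeping
  have h1ε : 0 < 1 - ε' := by linarith
  have hμ : 0 < Zd.connectiveConstant d := Zd.connectiveConstant_pos d
  have hμp : 0 < Zd.connectiveConstant d ^ (N + 1) := pow_pos hμ _
  -- `(1-ε')^{-(N+1)} ≤ exp((N+1) ε'/(1-ε'))`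
  have hbase : (1 - ε')⁻¹ ≤ Real.exp (ε' / (1 - ε')) := by
    have e : (1 - ε')⁻¹ = ε' / (1 - ε') + 1 := by
      field_simp
      ring
    rw [e]
    exact Real.add_one_le_exp _
  have hinvpow : ((1 - ε') ^ (N + 1))⁻¹ ≤ Real.exp (((N + 1 : ℕ) : ℝ) * (ε' / (1 - ε'))) := by
    rw [Real.exp_nat_mul, ← inv_pow]
    exact pow_le_pow_left₀ (inv_nonneg.2 h1ε.le) hbase _
  -- the two exponent pieces
  have e1 : Real.pi ^ 2 / (6 * L * ε') = Real.pi * s / (6 * L) := by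
    rw [hε']
    field_simp
  have e2 : ε' / (1 - ε') = Real.pi / (s - Real.pi) := by
    rw [hε']
    field_simp
  have hpoly : ((N : ℝ) + 1) * Real.pi * (6 * L) ≤
      (Real.pi * s + 2 * Real.pi ^ 2 + 6 * L) * (s - Real.pi) := by
    have hπs2 : Real.pi * s ^ 2 = Real.pi * (6 * L * N) := by rw [hs2]
    have key := mul_le_mul_of_nonneg_right h2πs (by positivity : (0 : ℝ) ≤ Real.pi ^ 2 + 6 * L)
    linear_combination key - hπs2
  have hB : ((N : ℝ) + 1) * (Real.pi / (s - Real.pi)) ≤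
      Real.pi * s / (6 * L) + Real.pi ^ 2 / (3 * L) + 1 := by
    rw [mul_div_assoc', div_le_iff₀ hsπ]
    have e : (Real.pi * s / (6 * L) + Real.pi ^ 2 / (3 * L) + 1) * (s - Real.pi) =
        ((Real.pi * s + 2 * Real.pi ^ 2 + 6 * L) * (s - Real.pi)) / (6 * L) := by
      field_simp
      ring
    rw [e, le_div_iff₀ (by positivity)]
    linarith [hpoly]
  have hsq : s / (3 * L) ≤ Real.sqrt (2 * N / (3 * L)) := by
    rw [Real.le_sqrt (by positivity) (by positivity), div_pow, hs2, div_le_div_iff₀ (by positivity) (by positivity)]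
    exact le_of_eq (by ring)
  have hE : Real.pi ^ 2 / (6 * L * ε') + ((N + 1 : ℕ) : ℝ) * (ε' / (1 - ε')) ≤
      Real.pi * Real.sqrt (2 * N / (3 * L)) + Real.pi ^ 2 / (3 * L) + 1 := by
    rw [e1, e2, Nat.cast_add, Nat.cast_one]
    have : Real.pi * s / (6 * L) + Real.pi * s / (6 * L) = Real.pi * (s / (3 * L)) := by
      field_simp
      ring
    linarith [hB, mul_le_mul_of_nonneg_left hsq hπ.le, this]
  -- combine
  calc (Zd.count d N : ℝ)
      ≤ Real.exp (Real.pi ^ 2 / (6 * L * ε')) * Zd.connectiveConstant d ^ (N + 1) /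
          (1 - ε') ^ (N + 1) := hA
    _ = Real.exp (Real.pi ^ 2 / (6 * L * ε')) * Zd.connectiveConstant d ^ (N + 1) *
          ((1 - ε') ^ (N + 1))⁻¹ := by rw [div_eq_mul_inv]
    _ ≤ Real.exp (Real.pi ^ 2 / (6 * L * ε')) * Zd.connectiveConstant d ^ (N + 1) *
          Real.exp (((N + 1 : ℕ) : ℝ) * (ε' / (1 - ε'))) := by
        gcongr
    _ = Real.exp (Real.pi ^ 2 / (6 * L * ε') + ((N + 1 : ℕ) : ℝ) * (ε' / (1 - ε'))) *
          Zd.connectiveConstant d ^ (N + 1) := by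
        rw [Real.exp_add]; ring
    _ ≤ Real.exp (Real.pi * Real.sqrt (2 * N / (3 * L)) + Real.pi ^ 2 / (3 * L) + 1) *
          Zd.connectiveConstant d ^ (N + 1) :=
        mul_le_mul_of_nonneg_right (Real.exp_le_exp.2 hE) hμp.le



/-- **Explicit Hammersley–Welsh exponent `B(v) = π√(2v/3)` from a rational window at speed `v = p/q`** (every
`d`): under `Zd.BridgeHeightDecayWindowQ d p q A c` with rate `c > 0`,
`c_N ≤ exp(π√(2pN/(3q)) + π²p/(3q) + 1) · μ^{N+1}` for all `N` with `2π²p ≤ 3qN` and `π²p((q-p)/(pc) + 1)² ≤ 6qN`.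
At `p = 1` this is `Zd.count_le_exp_sharp_of_window`; the dictionary `v ↦ π√(2v/3)` is this file's (print:
`π(2/3)^{1/2}`, Madras–Slade Theorem 3.1.1; ineffective `o(√n)`, Hutchcroft Theorem 1.2).
[cite: Hutchcroft2018HammersleyWelsh, Theorem 1.4; MadrasSlade1993, Theorem 3.1.1] -/
theorem count_le_exp_sharp_of_windowQ {p q : ℕ} {A c : ℝ} (h : BridgeHeightDecayWindowQ d p q A c)
    (hp : 1 ≤ p) (hpq : p ≤ q) (hc : 0 < c) (N : ℕ)
    (hN1 : 2 * Real.pi ^ 2 * p ≤ 3 * (q : ℝ) * N)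
    (hN2 : Real.pi ^ 2 * p * ((((q : ℝ) - p) / (p * c)) + 1) ^ 2 ≤ 6 * (q : ℝ) * N) :
    (Zd.count d N : ℝ) ≤
      Real.exp (Real.pi * Real.sqrt (2 * p * N / (3 * (q : ℝ))) + Real.pi ^ 2 * p / (3 * (q : ℝ)) + 1) *
        Zd.connectiveConstant d ^ (N + 1) := by
  have hp0 : (0 : ℝ) < p := by exact_mod_cast hp
  have hq0 : (0 : ℝ) < q := by exact_mod_cast (lt_of_lt_of_le hp hpq)
  set L : ℝ := (q : ℝ) / p with hLdef
  have hL : 1 ≤ L := by rw [hLdef, le_div_iff₀ hp0, one_mul]; exact_mod_cast hpq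
  -- R7.2 in the `L`-form
  have hA : ∀ ε' : ℝ, 0 < ε' → ε' < 1 → (L - 1) * ε' ≤ c * (1 - ε') → ∀ N : ℕ,
      (Zd.count d N : ℝ) ≤ Real.exp (Real.pi ^ 2 / (6 * L * ε')) *
        Zd.connectiveConstant d ^ (N + 1) / (1 - ε') ^ (N + 1) := by
    intro ε' hε0 hε1 hreg M
    have key := count_le_of_windowQ_prod h hp hpq hε0 hε1 (by rw [hLdef] at hreg; exact hreg) M
    have e : (p : ℝ) * Real.pi ^ 2 / (6 * (q : ℝ) * ε') = Real.pi ^ 2 / (6 * L * ε') := by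
      rw [hLdef]; field_simp
    rw [e] at key
    exact key
  have hN1' : 2 * Real.pi ^ 2 ≤ 3 * L * N := by
    rw [hLdef]
    have : 2 * Real.pi ^ 2 ≤ 3 * (q : ℝ) * N / p := by rw [le_div_iff₀ hp0]; linarith
    calc 2 * Real.pi ^ 2 ≤ 3 * (q : ℝ) * N / p := this
      _ = 3 * ((q : ℝ) / p) * N := by ring
  have hN2' : Real.pi ^ 2 * ((L - 1) / c + 1) ^ 2 ≤ 6 * L * N := by
    have e1 : (L - 1) / c = ((q : ℝ) - p) / (p * c) := by
      rw [hLdef]; field_simp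
    rw [e1, hLdef]
    have : Real.pi ^ 2 * (((q : ℝ) - p) / (p * c) + 1) ^ 2 ≤ 6 * (q : ℝ) * N / p := by
      rw [le_div_iff₀ hp0]; nlinarith
    calc Real.pi ^ 2 * (((q : ℝ) - p) / (p * c) + 1) ^ 2 ≤ 6 * (q : ℝ) * N / p := this
      _ = 6 * ((q : ℝ) / p) * N := by ring
  have key := count_le_exp_sharp_of_realWindowBound hL hc hA N hN1' hN2'
  have e2 : 2 * (N : ℝ) / (3 * L) = 2 * p * N / (3 * (q : ℝ)) := by rw [hLdef]; field_simp
  have e3 : Real.pi ^ 2 / (3 * L) = Real.pi ^ 2 * p / (3 * (q : ℝ)) := by rw [hLdef]; field_simp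
  rw [e2, e3] at key
  exact key


end Literature.Probability.RandomPlanarGeometry.SAW.Zd

end
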